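import Summits.BirchSwinnertonDyer.BirchSwinnertonDyer.Theses.RamifiedSevenEllipticUnits
import Summits.BirchSwinnertonDyer.BirchSwinnertonDyer.Theorems.RamifiedSevenEllipticUnitsRubinPackageOfTwist
import Summits.BirchSwinnertonDyer.BirchSwinnertonDyer.Theorems.RamifiedSevenEllipticUnitsGeneratorShapeOfPinned
import Summits.BirchSwinnertonDyer.BirchSwinnertonDyer.Theorems.RamifiedSevenEllipticUnitsRubinFormulaZpIffValue
import HarnessLib

set_option linter.dupNamespace false
set_option autoImplicit false

/-!
# K7r crux `EllipticUnitValueSevenOfGZK` (stmt-BirchSwinnertonDyer-19945), line `rubin-formula-zp` v4.5 —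
# THE RUBIN PACKAGE FROM PLAIN DEURING: `S_pkg ⟸ {S_pkg⁻, Hecke-FE, PLAIN Deuring, H_Rig⁰}`
# (cell `bsd-cm`, seat `bsd-cm-k7r-c2` g16, FILE B; helper `--supports` 19945; THEOREMS ONLY, nothing asserted)

HONEST FRAMING. The registered skeleton v4.5 (`2e480adc5d67667d`, planner D222) displays the PRINT stub
`stub_printFactsHeckeDeuringGenSevenLine := Hecke_functionalEquation_infinityType ∧
Deuring_exists_heckeCharacter_of_maximalCM_withGenerators` and derives S_pkg through seat k7r-c2 g13's
`RubinPackageOfTwist.rubinPackageAtZp_seven_of_hecke_of_deuringGenerators_of_reduced` (p528122), where clause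
(vi) of the W50 fact (generator values `ψ(ϖ_w) = σ(α_w)`, `(α_w) = 𝔭_w`: Silverman ATAEC II Thm. 9.1 (i) /
Prop. 10.4) feeds LEMMA Ξ for (P1)/(P5) — «the honest floor of this architecture» (D219). FILE A of this seat
(`…GeneratorShapeOfPinned`, `GeneratorShape.shape_of_pinned`) proved the generator shape for EVERY `(1, 0)`
character L-pinned to a curve over `ℚ` when `𝓞_K` is principal — from Neukirch (6.13) and the pinning read,
no CM theory. THIS FILE re-assembles S_pkg with the Deuring input WEAKENED TO THE TREE'S ORIGINAL FACT
`Deuring_exists_heckeCharacter_of_maximalCM` (clauses (i)–(v): Silverman II Thm. 9.2 + Thm. 10.5 (b); of it only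
(i) infinity type, (ii) equivariance and (v) `L(E/ℚ, s) = L(s, ψ)` are consumed here, (iii) by FILE 1 of g13
inside `interpolated_not_isUnramifiedAt`): `𝓞_K` is principal for the CM field of a maximal-order CM curve
(`isPrincipalIdealRing_of_isCMFieldOfJ`, tree), so FILE A applies to Deuring's `ψ` at the isogenous maximal model.
Everything else is g13's assembly VERBATIM. CONSEQUENCE (route-independent kernel records, NOT a registration):
S_pkg, the fit witness S_open and the crux BY NAME at every member of 𝒞₇ from Hecke-FE, PLAIN Deuring, S_pkg⁻
and S_arch — the W50 facts `…withGenerators` / `…withUnitValues` are consumed NOWHERE. A re-registration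
(v4.6, `stub_printFactsHeckeDeuringSevenLine := Hecke-FE ∧ Deuring_exists_heckeCharacter_of_maximalCM`, say) is
the planner's / line owner's pen. CONDITIONAL on the displayed inputs; plain Deuring remains an XL PRINT fact
(main theorem of CM); BSD is not proved for any curve; 19945 stays OPEN (S_pkg⁻ = [BKNO] PRE + readings,
S_arch = research).

* §1 `RubinPackageOfDeuring.exists_deuringCharacter_of_cmFieldDiscr` — PLAIN Deuring's `ψ` for a curve with CM
  field `ℚ(√−7)`, WITH the cofinite generator shape supplied by FILE A;
* §2 **`RubinPackageOfDeuring.rubinPackage_of_hecke_of_deuring_of_rigidity_of_reduced`**;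
* §3 𝒞₇ forms (S_pkg, S_open) and the crux-level record.

References: [BurungaleKobayashiNakamuraOta2026] Def. 4.7, Thm. 4.12, §4.1 (shape only); [SilvermanATAEC1994]
II 9.2, 10.4, 10.5; [deShalit1987] II.1.1; [NeukirchANT1999] VII (6.13), (8.1); [Miller2011LMS] Def. 1.1; cell
texts STATUS 2026-08-27 D219/D222, k7r-c2 g16 12:41Z.
-/

noncomputable section

open scoped Classical ComplexConjugate

open WeierstrassCurve NumberField IsDedekindDomain Field PowerSeries
  Literature.NumberTheory.EllipticCurves
  Literature.NumberTheory.EllipticCurves.Rank1Residual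
  Literature.NumberTheory.EllipticCurves.Rank1Residual.Typed
  Literature.NumberTheory.EllipticCurves.Castella2018
  Literature.NumberTheory.EllipticCurves.BurungaleKobayashiNakamuraOta2026
  Literature.NumberTheory.GaloisRepresentations
  Literature.NumberTheory.DiophantineGeometry
  Summit.BirchSwinnertonDyer.Rank1Residual.Additive

namespace Summit.BirchSwinnertonDyer.BirchSwinnertonDyer.Theorems.RamifiedSevenEllipticUnits

namespace RubinPackageOfDeuring

open Summit.BirchSwinnertonDyer.Rank1Residual Summit.BirchSwinnertonDyer.Rank1Residual.X12
  Summit.BirchSwinnertonDyer.Rank1Residual.X12.O11 RubinPackageOfReduced RubinPackageOfRigidity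
  RubinPackageOfTwist

/-! ## §1 PLAIN Deuring's character for a curve with CM field `ℚ(√−7)`, with the generator shape of FILE A -/

section Deuring

variable {K : Type} [Field K] [NumberField K]

/-- **PLAIN Deuring's character, WITH THE GENERATOR SHAPE AS A THEOREM.** For `V/ℚ` with CM and
`cmFieldDiscrOfJ V.j = −7`, `K` imaginary quadratic with `d_K = −7` and `c ≠ 1`: from the ORIGINAL named fact
`Deuring_exists_heckeCharacter_of_maximalCM` at the isogenous globally minimal maximal-order model `V₁` (same
`L`-series; `QuadraticRamification.exists_isogenous_maximal_model`) there is `ψ` of infinity type `(1, 0)`,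
conj-equivariant for `c`, pinned to `V`; and `𝓞_K` is principal (`isPrincipalIdealRing_of_isCMFieldOfJ`), so
FILE A (`GeneratorShape.shape_of_pinned`) gives an embedding `σ` and a finite set off which `ψ` is unramified
with `ψ(ϖ_w) = σ(α_w)`, `(α_w) = 𝔭_w`. CONDITIONAL on the named fact (hypothesis `hDe`).
[cite: SilvermanATAEC1994, Ch. II Thm. 9.2 and Thm. 10.5 (b) (Deuring's theorem; the generator values of Prop. 10.4 are DERIVED)] -/
theorem exists_deuringCharacter_of_cmFieldDiscr (hDe : Deuring_exists_heckeCharacter_of_maximalCM)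
    {V : WeierstrassCurve ℚ} [V.IsElliptic] (hVcm : V.HasCM) (hVj : cmFieldDiscrOfJ V.j = -7)
    (hK : IsImaginaryQuadratic K) (hdK : NumberField.discr K = -7) (c : K ≃ₐ[ℚ] K) (hc : c ≠ 1) :
    ∃ ψ : HeckeCharacter K,
      ψ.HasInfinityType (fun _ ↦ 1) (fun _ ↦ 0) ∧ IsHeckeConjEquivariant c ψ ∧
      (∀ s : ℂ, 3 / 2 < s.re → heckeLFunction ψ s = V.LSeries s) ∧
      ∃ (σ : K →+* ℂ) (S : Set (HeightOneSpectrum (𝓞 K))), S.Finite ∧ ∀ w ∉ S,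
        ψ.IsUnramifiedAt w ∧ ∃ α : 𝓞 K, Ideal.span {α} = w.asIdeal ∧ ψ.valueAtUniformizer w = σ (α : K) := by
  obtain ⟨V₁, _, _, -, hj₁, hd₁, hLV⟩ := QuadraticRamification.exists_isogenous_maximal_model hVcm
  rw [hVj] at hd₁
  have hKj : IsCMFieldOfJ K V₁.j := QuadraticRamification.isCMFieldOfJ_of_discr_eq hj₁ hd₁ hK.1 hdK
  haveI : IsPrincipalIdealRing (𝓞 K) := isPrincipalIdealRing_of_isCMFieldOfJ K hj₁ hKj
  obtain ⟨ψ, hinf, heq, -, -, hL⟩ := hDe V₁ hj₁ K hKj c hc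
  obtain ⟨w₀⟩ : Nonempty (InfinitePlace K) := inferInstance
  obtain ⟨S, hS, hshape⟩ := GeneratorShape.shape_of_pinned hK w₀ hinf V₁ (3 / 2) hL
  refine ⟨ψ, hinf, heq, fun s hs ↦ ?_, w₀.embedding, S, hS, hshape⟩
  rw [hLV]; exact hL s hs

end Deuring

/-! ## §2 THE ASSEMBLY FROM PLAIN DEURING: `S_pkg ⟸ {S_pkg⁻, Hecke-FE, Deuring, H_Rig⁰}` -/

section Assembly

variable {W : WeierstrassCurve ℚ} [W.IsElliptic] [W.IsGloballyMinimal] {D₀ : ℤ}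

omit [W.IsGloballyMinimal] in
/-- **`S_pkg` FROM THE REDUCED PACKAGE, HECKE'S FUNCTIONAL EQUATION, PLAIN DEURING AND PURE RIGIDITY —
NO GENERATOR VALUES, NO UNIT VALUES, NO GROSS, NO H_QR.** Verbatim seat k7r-c2 g13's
`RubinPackageOfTwist.rubinPackage_of_hecke_of_deuringGenerators_of_rigidity_of_reduced` (p528122) except that the
Deuring characters `ψ`, `ψ₀` of the member and of the base model come from the PLAIN fact
`Deuring_exists_heckeCharacter_of_maximalCM`, their generator shape (LEMMA Ξ's input for (P1)/(P5), both
orientations) being the THEOREM of FILE A (§1, `GeneratorShape.shape_galConj`). CONDITIONAL; nothing booked.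
[cite: BurungaleKobayashiNakamuraOta2026, Def. 4.7 and Thm. 4.12 (arXiv:2608.06879 pp. 27, 32; claim; preprint; shape only)]
[cite: SilvermanATAEC1994, Ch. II Thm. 9.2, Thm. 10.5 (b)] [cite: deShalit1987, II.1.1 (1)–(3)] -/
theorem rubinPackage_of_hecke_of_deuring_of_rigidity_of_reduced [Fact (Nat.Prime 7)]
    (hj : cmFieldDiscrOfJ W.j = -7) (hD₀ : D₀ ≠ 0)
    (hHecke : Hecke_functionalEquation_infinityType)
    (hDe : Deuring_exists_heckeCharacter_of_maximalCM)
    (hrig : RamifiedCMPinnedCharacterRigidityAtZp W 7)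
    (hred : RamifiedCMRubinPackageReducedAtZp W 7 D₀) :
    RamifiedCMRubinPackageAtZp W 7 D₀ := by
  intro K _ _ 𝔭 W' _ _ C hF hr κ hκ γ _ P n P' n' hP hgen htors hdiv hndiv hP' hgen' htors' hdiv' hndiv'
    q q' hq hq' ι φ Ω 𝓔 D c hΩ hφ hc himc l hl W₀ _ _ hW₀ φ₀ hφ₀ m r hcont hcont₀ hρ hr0 hlt
  obtain ⟨cK, hcK, R, Ω₀, 𝓔₀, D₀', R₀, hΩ₀, hbase, hper, hbottom⟩ :=
    hred K 𝔭 W' C hF hr κ hκ γ P n P' n' hP hgen htors hdiv hndiv hP' hgen' htors' hdiv' hndiv' q q' hq hq'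
      ι φ Ω 𝓔 D c hΩ hφ hc himc l hl W₀ hW₀ φ₀ hφ₀ m r hcont hcont₀ hρ hr0 hlt
  -- the frame: `K = ℚ(√−7)`, `7 ∈ 𝔭`; the member and the base model are CM with field `ℚ(√−7)`
  have hK : IsImaginaryQuadratic K := hF.2.2.2.1
  have h2 : Module.finrank ℚ K = 2 := hK.1
  have hdK : NumberField.discr K = -7 := by
    have h := hF.2.2.2.2.1
    rw [hj] at h
    exact h
  have hdK' : NumberField.discr K = -((7 : ℕ) : ℤ) := by rw [hdK]; norm_num
  have h7 : ((7 : ℕ) : 𝓞 K) ∈ 𝔭.asIdeal := by simpa using hF.2.2.2.2.2.1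
  have hnr : ∀ σ' : K →+* ℂ, ¬ ComplexEmbedding.IsReal σ' :=
    (LemmaXi.frame_fieldInputs (K := K) (p := 7) hK hdK' (by norm_num)).2.2.2.2.1
  have hWcm : W.HasCM := hF.1
  have hW₀cm : W₀.HasCM := RouteU.hasCM_of_twist_cm7 W₀ hD₀ hW₀
  have hW₀j' : cmFieldDiscrOfJ W₀.j = -7 := RouteU.cmFieldDiscrOfJ_of_twist_cm7 W₀ hD₀ hW₀
  have hW₀j : cmFieldDiscrOfJ W₀.j = cmFieldDiscrOfJ W.j := by rw [hW₀j', hj]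
  -- §1: PLAIN Deuring characters with the DERIVED generator shape; H_Rig⁰: the position of `φ`, `φ₀`
  obtain ⟨ψ, hinf, heq, hψ, σ, hσ⟩ := exists_deuringCharacter_of_cmFieldDiscr hDe hWcm hj hK hdK cK hcK
  obtain ⟨ψ₀, hinf₀, heq₀, hψ₀, σ₀, hσ₀⟩ :=
    exists_deuringCharacter_of_cmFieldDiscr hDe hW₀cm hW₀j' hK hdK cK hcK
  have hφcase : φ = ψ ∨ φ = HeckeCharacter.galConj cK ψ :=
    hrig K 𝔭 W' C hF W hWcm rfl cK hcK ψ φ hinf heq hψ hφ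
  have hφ₀case : φ₀ = ψ₀ ∨ φ₀ = HeckeCharacter.galConj cK ψ₀ :=
    hrig K 𝔭 W' C hF W₀ hW₀cm hW₀j cK hcK ψ₀ φ₀ hinf₀ heq₀ hψ₀ hφ₀
  -- (P1)/(P5) for `R` and `R₀` from the generator shape (k7r-c2's frame theorem), both orientations
  have hP15 : R.ξ = φ * (HeckeCharacter.galConj cK φ)⁻¹ ∧
      ‖avatarValueAt R.r γ - 1‖ ^ 2 = (((7 : ℕ) : ℝ))⁻¹ := by
    rcases hφcase with h | h
    · subst h
      exact RubinPadicLFunctionData.ξ_eq_φac_and_norm_sq_of_frame R hK hdK' (by norm_num) h7 hcK σ heq hσ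
    · subst h
      exact RubinPadicLFunctionData.ξ_eq_φac_and_norm_sq_of_frame R hK hdK' (by norm_num) h7 hcK
        (σ.comp (cK : K →+* K)) (isHeckeConjEquivariant_galConj h2 heq)
        (GeneratorShape.shape_galConj h2 hcK heq σ (hnr σ) hσ)
  have hP15₀ : R₀.ξ = φ₀ * (HeckeCharacter.galConj cK φ₀)⁻¹ ∧
      ‖avatarValueAt R₀.r γ - 1‖ ^ 2 = (((7 : ℕ) : ℝ))⁻¹ := by
    rcases hφ₀case with h | h
    · subst h
      exact RubinPadicLFunctionData.ξ_eq_φac_and_norm_sq_of_frame R₀ hK hdK' (by norm_num) h7 hcK σ₀ heq₀ hσ₀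
    · subst h
      exact RubinPadicLFunctionData.ξ_eq_φac_and_norm_sq_of_frame R₀ hK hdK' (by norm_num) h7 hcK
        (σ₀.comp (cK : K →+* K)) (isHeckeConjEquivariant_galConj h2 heq₀)
        (GeneratorShape.shape_galConj h2 hcK heq₀ σ₀ (hnr σ₀) hσ₀)
  obtain ⟨hξ, hu⟩ := hP15
  obtain ⟨hξ₀, hu₀⟩ := hP15₀
  -- (P2): Hecke's functional equation for `ψ^{2k+1}`, `ψ₀^{2k+1}`, transported to `φ`, `φ₀`
  have hw : ∃ w : ℂ, IsCentralRootNumberWt (φ ^ (2 * 7 ^ m + 1)) (7 ^ m) w := by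
    obtain ⟨w, -, hw⟩ := exists_isCentralRootNumberWt_pow hHecke hK hinf heq (7 ^ m)
    rcases hφcase with h | h
    · exact ⟨w, h ▸ hw⟩
    · exact ⟨w, h ▸ (isCentralRootNumberWt_galConj_pow_iff cK ψ _ _ w).2 hw⟩
  have hw₀ : ∃ w : ℂ, IsCentralRootNumberWt (φ₀ ^ (2 * 7 ^ m + 1)) (7 ^ m) w := by
    obtain ⟨w, -, hw⟩ := exists_isCentralRootNumberWt_pow hHecke hK hinf₀ heq₀ (7 ^ m)
    rcases hφ₀case with h | h
    · exact ⟨w, h ▸ hw⟩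
    · exact ⟨w, h ▸ (isCentralRootNumberWt_galConj_pow_iff cK ψ₀ _ _ w).2 hw⟩
  obtain ⟨w, hw⟩ := hw
  obtain ⟨w₀, hw₀⟩ := hw₀
  have hsgn := RubinPackageReduction.isCentralRootNumberWt_interpolated_one_of_xi hξ hξ₀ hw hw₀ hρ hr0
  -- (P3): at `𝔭` by g13's FILE 2 (equivariance), away from `𝔭` by g13's FILE 1 (twist transport) — PLAIN Deuring
  exact ⟨cK, R, Ω₀, 𝓔₀, D₀', R₀, hξ, hξ₀, hsgn.1, hsgn.2,
    interpolated_not_isUnramifiedAt hDe hK hdK h7 cK hcK W hWcm hj ψ hinf heq hψ hφcase hφ hξ m,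
    interpolated_not_isUnramifiedAt hDe hK hdK h7 cK hcK W₀ hW₀cm hW₀j' ψ₀ hinf₀ heq₀ hψ₀ hφ₀case hφ₀ hξ₀ m,
    hΩ₀, hu, hu₀, hbase, hper, hbottom⟩

end Assembly

/-! ## §3 On 𝒞₇: S_pkg, S_open and the crux-level record from PLAIN Deuring -/

section ClassCSeven

variable {W : WeierstrassCurve ℚ} [W.IsElliptic] [W.IsGloballyMinimal]

/-- **S_pkg ⟸ Hecke-FE ∧ PLAIN Deuring ∧ S_pkg⁻ at a member of 𝒞₇, every `D₀ ≠ 0`** (H_Rig⁰ is the tree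
theorem `pinnedCharacterRigidityAtZp`). CONDITIONAL; nothing about BSD.
[cite: BurungaleKobayashiNakamuraOta2026, Def. 4.7, Thm. 4.12 and Thm. 7.2 (arXiv:2608.06879 pp. 27, 32, 41) (claim; preprint; shape only)]
[cite: deShalit1987, II.1.1 (1)–(3)] [cite: SilvermanATAEC1994, Ch. II Thm. 9.2, Thm. 10.5 (b)] -/
theorem rubinPackageAtZp_seven_of_hecke_of_deuring_of_reduced [Fact (Nat.Prime 7)] {D₀ : ℤ}
    (hD₀ : D₀ ≠ 0) (hHecke : Hecke_functionalEquation_infinityType)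
    (hDe : Deuring_exists_heckeCharacter_of_maximalCM) (hC : ClassCSeven W)
    (hred : RamifiedCMRubinPackageReducedAtZp W 7 D₀) : RamifiedCMRubinPackageAtZp W 7 D₀ :=
  rubinPackage_of_hecke_of_deuring_of_rigidity_of_reduced hC.2.1 hD₀ hHecke hDe
    (pinnedCharacterRigidityAtZp W 7) hred

/-- **S_open at a member ⟸ Hecke-FE ∧ PLAIN Deuring ∧ S_pkg⁻ ∧ S_arch (base `D₀ = −11`).**
[cite: BurungaleKobayashiNakamuraOta2026, §1.4 (arXiv:2608.06879 p. 8) (the deferred value formula; shape only)] -/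
theorem rubinFormulaAtZp_seven_of_hecke_of_deuring_of_reduced_of_archimedean [Fact (Nat.Prime 7)]
    (hHecke : Hecke_functionalEquation_infinityType)
    (hDe : Deuring_exists_heckeCharacter_of_maximalCM) (hC : ClassCSeven W)
    (hred : RamifiedCMRubinPackageReducedAtZp W 7 (-11))
    (harch : RamifiedCMArchimedeanValuationAtZp W 7 (-11)) : RamifiedCMRubinFormulaAtZp W 7 :=
  ramifiedCMRubinFormulaAtZp_of_relativeValuation_of_archimedean
    (RelativeValuationOfPackage.ramifiedCMRelativeValuationAtZp_of_package
      (rubinPackageAtZp_seven_of_hecke_of_deuring_of_reduced (by norm_num) hHecke hDe hC hred)) harch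

/-- **KERNEL RECORD: Hecke-FE ∧ PLAIN Deuring ∧ S_pkg⁻|𝒞₇ ∧ S_arch|𝒞₇ ⟹ the crux `EllipticUnitValueSevenOfGZK`
BY NAME — the generator-values clause (vi) of v4.5's H_Facts is consumed NOWHERE.** Hypotheses = the statements
of the registered stubs S_pkg⁻ and S_arch of skeleton v4.5 VERBATIM and, in place of
`stub_printFactsHeckeDeuringGenSevenLine = Hecke-FE ∧ Deuring-G`, the WEAKER pair Hecke-FE ∧ PLAIN Deuring
(the tree's original fact). CONDITIONAL kernel record; nothing registered; credits nothing; closes nothing;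
BSD is not proved for any curve. [cite: Miller2011LMS, Def. 1.1 (arXiv:1010.2431 p. 3)]
[cite: BurungaleKobayashiNakamuraOta2026, Def. 4.7, Thm. 4.12, Thm. 7.2 and §1.4 (arXiv:2608.06879 pp. 8, 27, 32, 41) (claim; preprint; shape only)]
[cite: SilvermanATAEC1994, Ch. II Thm. 9.2, Thm. 10.5 (b) (Deuring's theorem)] -/
theorem valueSevenOfGZK_of_hecke_of_deuring_of_reduced_of_archimedean
    (hHecke : Hecke_functionalEquation_infinityType)
    (hDe : Deuring_exists_heckeCharacter_of_maximalCM)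
    (hred : ∀ (W : WeierstrassCurve ℚ) [W.IsElliptic] [W.IsGloballyMinimal] [Fact (Nat.Prime 7)],
      ClassCSeven W → RamifiedCMRubinPackageReducedAtZp W 7 (-11))
    (harch : ∀ (W : WeierstrassCurve ℚ) [W.IsElliptic] [W.IsGloballyMinimal] [Fact (Nat.Prime 7)],
      ClassCSeven W → RamifiedCMArchimedeanValuationAtZp W 7 (-11)) :
    Summit.BirchSwinnertonDyer.BirchSwinnertonDyer.Theses.RamifiedSevenEllipticUnits.EllipticUnitValueSevenOfGZK :=
  RubinFormulaZpIffValue.valueSevenOfGZK_of_rubinFormulaSevenZp fun W _ _ _ hC ↦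
    rubinFormulaAtZp_seven_of_hecke_of_deuring_of_reduced_of_archimedean hHecke hDe hC (hred W hC) (harch W hC)

/-- **The v4.5 print stub's SECOND CONJUNCT CAN BE WEAKENED TO PLAIN DEURING**: Hecke-FE ∧ Deuring already
give, with S_pkg⁻|𝒞₇ and S_arch|𝒞₇, the registered fit witness `stub_rubinFormulaSevenZp`'s statement
(`∀ W ∈ 𝒞₇, RamifiedCMRubinFormulaAtZp W 7`, the line's S_open). CONDITIONAL; nothing registered.
[cite: BurungaleKobayashiNakamuraOta2026, §1.4 (arXiv:2608.06879 p. 8) (shape only)] -/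
theorem rubinFormulaSevenZp_of_hecke_of_deuring_of_reduced_of_archimedean
    (hHecke : Hecke_functionalEquation_infinityType)
    (hDe : Deuring_exists_heckeCharacter_of_maximalCM)
    (hred : ∀ (W : WeierstrassCurve ℚ) [W.IsElliptic] [W.IsGloballyMinimal] [Fact (Nat.Prime 7)],
      ClassCSeven W → RamifiedCMRubinPackageReducedAtZp W 7 (-11))
    (harch : ∀ (W : WeierstrassCurve ℚ) [W.IsElliptic] [W.IsGloballyMinimal] [Fact (Nat.Prime 7)],
      ClassCSeven W → RamifiedCMArchimedeanValuationAtZp W 7 (-11)) :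
    ∀ (W : WeierstrassCurve ℚ) [W.IsElliptic] [W.IsGloballyMinimal] [Fact (Nat.Prime 7)],
      ClassCSeven W → RamifiedCMRubinFormulaAtZp W 7 :=
  fun W _ _ _ hC ↦
    rubinFormulaAtZp_seven_of_hecke_of_deuring_of_reduced_of_archimedean hHecke hDe hC (hred W hC) (harch W hC)

/-- **Drop-in under the REGISTERED v4.5 stub statements** (`Hecke-FE ∧ Deuring-G`, S_pkg⁻, S_arch): the crux
through PLAIN Deuring only (`Deuring_exists_heckeCharacter_of_maximalCM_of_withGenerators` forgets clause (vi) at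
once) — a closure in which clause (vi) is projected away and never used. CONDITIONAL; nothing registered.
[cite: Miller2011LMS, Def. 1.1 (arXiv:1010.2431 p. 3)] -/
theorem valueSevenOfGZK_of_printFactsHeckeDeuringGen_via_plainDeuring
    (hF : Hecke_functionalEquation_infinityType ∧ Deuring_exists_heckeCharacter_of_maximalCM_withGenerators)
    (hred : ∀ (W : WeierstrassCurve ℚ) [W.IsElliptic] [W.IsGloballyMinimal] [Fact (Nat.Prime 7)],
      ClassCSeven W → RamifiedCMRubinPackageReducedAtZp W 7 (-11))
    (harch : ∀ (W : WeierstrassCurve ℚ) [W.IsElliptic] [W.IsGloballyMinimal] [Fact (Nat.Prime 7)],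
      ClassCSeven W → RamifiedCMArchimedeanValuationAtZp W 7 (-11)) :
    Summit.BirchSwinnertonDyer.BirchSwinnertonDyer.Theses.RamifiedSevenEllipticUnits.EllipticUnitValueSevenOfGZK ∧
      ∀ (W : WeierstrassCurve ℚ) [W.IsElliptic] [W.IsGloballyMinimal] [Fact (Nat.Prime 7)],
        ClassCSeven W → RamifiedCMRubinFormulaAtZp W 7 :=
  ⟨valueSevenOfGZK_of_hecke_of_deuring_of_reduced_of_archimedean hF.1
      (Deuring_exists_heckeCharacter_of_maximalCM_of_withGenerators hF.2) hred harch,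
    rubinFormulaSevenZp_of_hecke_of_deuring_of_reduced_of_archimedean hF.1
      (Deuring_exists_heckeCharacter_of_maximalCM_of_withGenerators hF.2) hred harch⟩

end ClassCSeven

end RubinPackageOfDeuring

end Summit.BirchSwinnertonDyer.BirchSwinnertonDyer.Theorems.RamifiedSevenEllipticUnits

end
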